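import Summits.QuantumAdvantage.QuantumAdvantage.Theorems.DigitRung.Negative.WalshAndIndependence
import Literature.NumberTheory.QuadraticFields.ThreeTorsionMean
import Literature.NumberTheory.QuadraticFields.ThreeTorsionMeanProofs

/-!
# `DigitRung` (stmt-QuantumAdvantage-2423), line `Sketch` — stub `stub_low` (bounded depths)

For every fixed `K₀`, the centred Weyl sums
`W(n,k,r) = Σ_{d ∈ 𝒟_n} (#Cl₃(−d) − 2)·e(d·r/2^k)` at the bounded depths `1 ≤ k ≤ K₀` are
`o(#𝒟_n)`, uniformly in `k ≤ K₀` and `r`. Pure bookkeeping from the route's support item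
`EndJuntaRung` (stmt-QuantumAdvantage-2426), consumed as a hypothesis: at level `k` it says that every
end-cylinder (fixing the `k` lowest and `k` highest bits of `d`) has centred sum `≤ ε·#𝒟_n`
eventually. The block `𝒟_n` is the disjoint union of the `≤ 4^k` fibres of
`d ↦ (d mod 2^k, ⌊d/2^{n−k}⌋)`, each non-empty fibre is such a cylinder (`fibre_eq_cylinder`), and
on each fibre the phase `e(d·r/2^k)` is constant of modulus one (it only depends on `d mod 2^k`);
so `‖W‖ ≤ 4^k · (ε/4^k) · #𝒟_n`.
-/

noncomputable section

namespace Summit.QuantumAdvantage.DigitRung.Sketch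

open scoped Classical FourierTransform
open Filter Finset
open Literature.NumberTheory.QuadraticFields
open Summit.QuantumAdvantage.DigitRung.Negative
open Summit.QuantumAdvantage.QuantumAdvantage.Theses.ArithStatLadder (EndJuntaRung)

namespace StubLow

/-- `EndJuntaRung` at the canonical statistic `#Cl₃` (pinned by `pins_canonical`), in the
`block` vocabulary. [folklore] -/
theorem endJunta_block (hEJ : EndJuntaRung) (k : ℕ) (ε : ℝ) (hε : 0 < ε) :
    ∀ᶠ n : ℕ in atTop, ∀ a : ℕ → Bool,
      |∑ d ∈ (block n).filter
          (fun d : ℕ => ∀ i < n, (i < k ∨ n ≤ i + k) → Nat.testBit d i = a i),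
        ((quadFieldThreeTorsion (-(d:ℤ)) : ℝ) - 2)| ≤ ε * ((block n).card : ℝ) :=
  hEJ quadFieldThreeTorsion pins_canonical k ε hε

/-- The fibre of `d₀ ∈ 𝒟_n` under `d ↦ (d mod 2^k, ⌊d/2^{n−k}⌋)` inside the block is the
end-cylinder at level `k ≤ n` of `d₀`'s own bit pattern. [folklore] -/
theorem fibre_eq_cylinder {n k d₀ : ℕ} (hkn : k ≤ n) (hd₀ : d₀ ∈ block n) :
    (block n).filter
        (fun d : ℕ => (d % 2 ^ k, d / 2 ^ (n - k)) = (d₀ % 2 ^ k, d₀ / 2 ^ (n - k))) =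
      (block n).filter
        (fun d : ℕ => ∀ i < n, (i < k ∨ n ≤ i + k) → Nat.testBit d i = Nat.testBit d₀ i) := by
  -- adapted from `cylinder_eq_of_mem` (Theorems/ArithStatLadderEndJuntaRungCylinders.lean)
  obtain ⟨⟨-, hd₀n⟩, -⟩ := mem_block.mp hd₀
  refine Finset.filter_congr fun d hd => ?_
  obtain ⟨⟨-, hdn⟩, -⟩ := mem_block.mp hd
  rw [Prod.mk.injEq]
  constructor
  · rintro ⟨hmod, hdiv⟩ i hi hik
    rcases hik with hik | hik
    · have h1 := congrArg (fun x => Nat.testBit x i) hmod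
      simpa only [Nat.testBit_mod_two_pow, hik, decide_true, Bool.true_and] using h1
    · have h1 := congrArg (fun x => Nat.testBit x (i - (n - k))) hdiv
      simp only [Nat.testBit_div_two_pow] at h1
      rwa [show i - (n - k) + (n - k) = i by omega] at h1
  · intro ha
    constructor
    · refine Nat.eq_of_testBit_eq fun i => ?_
      rw [Nat.testBit_mod_two_pow, Nat.testBit_mod_two_pow]
      by_cases hi : i < k
      · rw [ha i (by omega) (Or.inl hi)]
      · simp [hi]
    · refine Nat.eq_of_testBit_eq fun i => ?_
      rw [Nat.testBit_div_two_pow, Nat.testBit_div_two_pow]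
      by_cases hi : i + (n - k) < n
      · rw [ha _ hi (Or.inr (by omega))]
      · rw [Nat.testBit_lt_two_pow (hdn.trans_le (Nat.pow_le_pow_right two_pos (by omega))),
          Nat.testBit_lt_two_pow (hd₀n.trans_le (Nat.pow_le_pow_right two_pos (by omega)))]

/-- Periodicity: `e(d·r/2^k) = e((d mod 2^k)·r/2^k)`. [folklore] -/
theorem fourierChar_mod (k r d : ℕ) :
    (𝐞 ((d : ℝ) * ((r : ℝ) / 2 ^ k)) : ℂ) = 𝐞 (((d % 2 ^ k : ℕ) : ℝ) * ((r : ℝ) / 2 ^ k)) := by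
  have h2 : (2 : ℝ) ^ k ≠ 0 := by positivity
  have hd : (d : ℝ) = 2 ^ k * ((d / 2 ^ k : ℕ) : ℝ) + ((d % 2 ^ k : ℕ) : ℝ) := by
    exact_mod_cast (Nat.div_add_mod d (2 ^ k)).symm
  have key : (d : ℝ) * ((r : ℝ) / 2 ^ k) =
      ((d % 2 ^ k : ℕ) : ℝ) * ((r : ℝ) / 2 ^ k) + ((d / 2 ^ k * r : ℕ) : ℝ) := by
    rw [hd]
    push_cast
    field_simp
    ring
  -- `e(m) = 1` for the natural number `m = ⌊d/2^k⌋·r`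
  have hone : (𝐞 ((d / 2 ^ k * r : ℕ) : ℝ) : ℂ) = 1 := by
    rw [Real.fourierChar_apply', ← Int.cast_natCast (R := ℝ) (d / 2 ^ k * r),
      Circle.exp_two_pi_mul_int, Circle.coe_one]
  rw [key, AddChar.map_add_eq_mul, Circle.coe_mul, hone, mul_one]

/-- `e(d·r/2^k)` depends only on `d mod 2^k`. [folklore] -/
theorem fourierChar_eq_of_mod_eq {k d d' : ℕ} (r : ℕ) (h : d % 2 ^ k = d' % 2 ^ k) :
    (𝐞 ((d : ℝ) * ((r : ℝ) / 2 ^ k)) : ℂ) = 𝐞 ((d' : ℝ) * ((r : ℝ) / 2 ^ k)) := by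
  rw [fourierChar_mod k r d, fourierChar_mod k r d', h]

/-- The complex centred sum is the real centred sum. [folklore] -/
theorem sum_complex_eq (S : Finset ℕ) :
    ∑ d ∈ S, ((quadFieldThreeTorsion (-(d:ℤ)) : ℂ) - 2) =
      ((∑ d ∈ S, ((quadFieldThreeTorsion (-(d:ℤ)) : ℝ) - 2) : ℝ) : ℂ) := by
  push_cast
  rfl

/-- On a fibre of `d ↦ (d mod 2^k, ⌊d/2^{n−k}⌋)` the phase `e(d·r/2^k)` is constant of modulus one,
so the twisted centred sum has the modulus of the plain centred sum. [folklore] -/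
theorem norm_fibre_eq (n k r : ℕ) (p : ℕ × ℕ) :
    ‖∑ d ∈ (block n).filter (fun d : ℕ => (d % 2 ^ k, d / 2 ^ (n - k)) = p),
        ((quadFieldThreeTorsion (-(d:ℤ)) : ℂ) - 2) * (𝐞 ((d : ℝ) * ((r : ℝ) / 2 ^ k)) : ℂ)‖ =
      |∑ d ∈ (block n).filter (fun d : ℕ => (d % 2 ^ k, d / 2 ^ (n - k)) = p),
        ((quadFieldThreeTorsion (-(d:ℤ)) : ℝ) - 2)| := by
  have hphase : ∀ d ∈ (block n).filter (fun d : ℕ => (d % 2 ^ k, d / 2 ^ (n - k)) = p),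
      (𝐞 ((d : ℝ) * ((r : ℝ) / 2 ^ k)) : ℂ) = 𝐞 ((p.1 : ℝ) * ((r : ℝ) / 2 ^ k)) := by
    intro d hd
    have h := (Finset.mem_filter.mp hd).2
    subst h
    exact fourierChar_eq_of_mod_eq r (Nat.mod_mod _ _).symm
  rw [Finset.sum_congr rfl fun d hd => by rw [hphase d hd], ← Finset.sum_mul, norm_mul,
    Circle.norm_coe, mul_one, sum_complex_eq, Complex.norm_real, Real.norm_eq_abs]

/-- **Fibre decomposition bound.** If every end-cylinder at level `k ≤ n` has centred sum `≤ δ`,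
the centred Weyl sum at any frequency `r/2^k` has modulus `≤ 4^k·δ`: the block is the disjoint
union of the `4^k` fibres of `d ↦ (d mod 2^k, ⌊d/2^{n−k}⌋) ∈ [0,2^k)²`, each non-empty fibre is an
end-cylinder (`fibre_eq_cylinder`), and the phase is constant on it. [folklore] -/
theorem norm_weyl_le {n k : ℕ} (hkn : k ≤ n) (r : ℕ) {δ : ℝ} (hδ : 0 ≤ δ)
    (hcyl : ∀ a : ℕ → Bool,
      |∑ d ∈ (block n).filter
          (fun d : ℕ => ∀ i < n, (i < k ∨ n ≤ i + k) → Nat.testBit d i = a i),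
        ((quadFieldThreeTorsion (-(d:ℤ)) : ℝ) - 2)| ≤ δ) :
    ‖∑ d ∈ block n, ((quadFieldThreeTorsion (-(d:ℤ)) : ℂ) - 2) *
        (𝐞 ((d : ℝ) * ((r : ℝ) / 2 ^ k)) : ℂ)‖ ≤ 4 ^ k * δ := by
  have hmaps : ∀ d ∈ block n,
      (d % 2 ^ k, d / 2 ^ (n - k)) ∈ Finset.range (2 ^ k) ×ˢ Finset.range (2 ^ k) := by
    intro d hd
    obtain ⟨⟨-, hdn⟩, -⟩ := mem_block.mp hd
    simp only [Finset.mem_product, Finset.mem_range]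
    refine ⟨Nat.mod_lt _ (by positivity), ?_⟩
    rw [Nat.div_lt_iff_lt_mul (by positivity), ← pow_add, Nat.add_sub_of_le hkn]
    exact hdn
  have hfibre : ∀ p ∈ Finset.range (2 ^ k) ×ˢ Finset.range (2 ^ k),
      ‖∑ d ∈ (block n).filter (fun d : ℕ => (d % 2 ^ k, d / 2 ^ (n - k)) = p),
        ((quadFieldThreeTorsion (-(d:ℤ)) : ℂ) - 2) * (𝐞 ((d : ℝ) * ((r : ℝ) / 2 ^ k)) : ℂ)‖
        ≤ δ := by
    intro p _
    rw [norm_fibre_eq n k r p]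
    rcases ((block n).filter
        (fun d : ℕ => (d % 2 ^ k, d / 2 ^ (n - k)) = p)).eq_empty_or_nonempty with he | ⟨d₀, hd₀⟩
    · rw [he, Finset.sum_empty, abs_zero]
      exact hδ
    · obtain ⟨hd₀b, hp⟩ := Finset.mem_filter.mp hd₀
      rw [← hp, fibre_eq_cylinder hkn hd₀b]
      exact hcyl _
  have h4 : (4 : ℝ) ^ k = 2 ^ k * 2 ^ k := by
    rw [← mul_pow]
    norm_num
  rw [← Finset.sum_fiberwise_of_maps_to hmaps]
  calc ‖∑ p ∈ Finset.range (2 ^ k) ×ˢ Finset.range (2 ^ k),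
        ∑ d ∈ (block n).filter (fun d : ℕ => (d % 2 ^ k, d / 2 ^ (n - k)) = p),
          ((quadFieldThreeTorsion (-(d:ℤ)) : ℂ) - 2) * (𝐞 ((d : ℝ) * ((r : ℝ) / 2 ^ k)) : ℂ)‖
      ≤ ∑ p ∈ Finset.range (2 ^ k) ×ˢ Finset.range (2 ^ k),
        ‖∑ d ∈ (block n).filter (fun d : ℕ => (d % 2 ^ k, d / 2 ^ (n - k)) = p),
          ((quadFieldThreeTorsion (-(d:ℤ)) : ℂ) - 2) * (𝐞 ((d : ℝ) * ((r : ℝ) / 2 ^ k)) : ℂ)‖ :=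
        norm_sum_le _ _
    _ ≤ ∑ _p ∈ Finset.range (2 ^ k) ×ˢ Finset.range (2 ^ k), δ := Finset.sum_le_sum hfibre
    _ = 4 ^ k * δ := by
        rw [Finset.sum_const, nsmul_eq_mul, Finset.card_product, Finset.card_range, h4]
        push_cast
        ring

end StubLow

/-- **Stub (bounded depths `k ≤ K₀`).** For every fixed `K₀`, the centred Weyl sums at odd `r/2^k`,
`1 ≤ k ≤ K₀`, are `o(#𝒟_n)`: the mean of `#Cl₃(−d)` is `2` in every class of `d (mod 2^{K₀})` met by
fundamental `−d`. Bookkeeping from the route's support item `EndJuntaRung` (stmt-QuantumAdvantage-2426)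
at the levels `k ≤ K₀` (finitely many, so the eventualities intersect): the block is the disjoint
union of the `4^k` end-cylinders fixing the `k` lowest and `k` highest bits, on each of which the
phase `e(d·r/2^k)` is constant. [folklore] -/
theorem stub_low (hEJ : EndJuntaRung) :
    ∀ K₀ : ℕ, ∀ ε : ℝ, 0 < ε → ∀ᶠ n : ℕ in atTop, ∀ k r : ℕ, 1 ≤ k → k ≤ K₀ → Odd r → r < 2 ^ k →
      ‖∑ d ∈ block n, ((quadFieldThreeTorsion (-(d:ℤ)) : ℂ) - 2) *
          (𝐞 ((d : ℝ) * ((r : ℝ) / 2 ^ k)) : ℂ)‖ ≤ ε * ((block n).card : ℝ) := by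
  intro K₀ ε hε
  have hev : ∀ᶠ n : ℕ in atTop, ∀ k ∈ Finset.range (K₀ + 1), ∀ a : ℕ → Bool,
      |∑ d ∈ (block n).filter
          (fun d : ℕ => ∀ i < n, (i < k ∨ n ≤ i + k) → Nat.testBit d i = a i),
        ((quadFieldThreeTorsion (-(d:ℤ)) : ℝ) - 2)| ≤ ε / 4 ^ k * ((block n).card : ℝ) := by
    rw [Filter.eventually_all_finset]
    intro k _
    exact StubLow.endJunta_block hEJ k (ε / 4 ^ k) (by positivity)
  filter_upwards [hev, eventually_ge_atTop K₀] with n hn hKn k r _hk1 hkK _hro _hr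
  have h := StubLow.norm_weyl_le (hkK.trans hKn) r (by positivity)
    (hn k (Finset.mem_range.mpr (Nat.lt_succ_of_le hkK)))
  calc ‖∑ d ∈ block n, ((quadFieldThreeTorsion (-(d:ℤ)) : ℂ) - 2) *
          (𝐞 ((d : ℝ) * ((r : ℝ) / 2 ^ k)) : ℂ)‖
      ≤ 4 ^ k * (ε / 4 ^ k * ((block n).card : ℝ)) := h
    _ = ε * ((block n).card : ℝ) := by field_simp

end Summit.QuantumAdvantage.DigitRung.Sketch

end
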